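import Mathlib
import HarnessLib
import Literature.NumberTheory.Automorphic.UnitaryCoherentGaloisRep
import Literature.NumberTheory.GaloisRepresentations.HeckeDeterminant
import Summits.Langlands.Langlands.Theses.QuadraticWindow

/-!
# Sketch — crux-ideate `stmt-Langlands-15129` (`GaloisRepOfUnitaryLDS`), ideator 1, round 1

First lemmas of the two idea cards, stated over existing declarations (elaboration only;
nothing here is proved or proposed).

* Card A `interior-eigenvariety-accumulation`:
  `GaloisRepOfUnitaryDiscreteSeries` (REG: the regular = discrete-series input, ANY level at `ℓ`)
  and `LDSEigenApproxByDiscreteSeries` (the lever: every NDLDS cuspidal `σ` unramified above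
  `ℓ` is an `ℓ`-adic limit, uniformly on its good Hecke–Satake data, of DISCRETE-SERIES cuspidal
  `π'` of the same tame level — Boxer–Pilloni, Higher Coleman theory, Thm. 6.9.? (342) +
  classicality at small slope + accumulation).
* Card B `classical-hecke-algebra-point`:
  `GaloisRepOfHeckeDeterminantPackages` (the docking theorem: Hecke-ALGEBRA-valued determinant
  packages modulo `ℓ^m`, with a bounded nilpotent ideal, give the semisimple `r` — no single
  approximant needed; receives Pilloni–Stroh Thm. 3.6 / Scholze Thm. IV.3.1 + Cor. V.1.11).
-/

open scoped NumberField Polynomial NNReal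
open IsDedekindDomain NumberField Field
open Literature.NumberTheory.Automorphic Literature.NumberTheory.GaloisRepresentations

namespace Summit.Langlands.Langlands.Cruxes.GaloisRepOfUnitaryLDS.Sketch

/-- **REG** (card A, stub T1): Galois representations for cuspidal `π'` on Mok's quasi-split
`U_{K/F₀}(N)` which are DISCRETE SERIES (`d.IsRegular`) at every real place, with NO hypothesis at
`ℓ` (arbitrary level above `ℓ`), compatibility at every `u ∤ ℓ` over a rational prime unramified
in `K` above which `π'` is unramified.  Printed: [HLTT] Cor. 1.3 = Shin 2011 + Labesse (GK 2019,
Rem. 11.1.1); Scholze 2015 Cor. V.1.7 (for `U(n,n)`, weights `k ≥ n`). -/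
def GaloisRepOfUnitaryDiscreteSeries : Prop :=
  ∀ (F₀ K : Type) [Field F₀] [NumberField F₀] [Field K] [NumberField K] [Algebra F₀ K]
    (cK : K ≃ₐ[F₀] K), IsTotallyReal F₀ → Module.finrank F₀ K = 2 → ∀ (hc : cK ≠ 1),
    IsTotallyComplex K → ∀ (N : ℕ) (ℓ : ℕ) [Fact ℓ.Prime] (ι : PadicAlgCl ℓ ≃+* ℂ)
    (hcptK : isCompact_glFiniteIntegralLevel N K)
    (π' : UnitaryGroup.CuspidalAutomorphicRepData F₀ K cK N hcptK),
    (∀ (w : {w : InfinitePlace K // w.IsComplex}) (hw : cK • w.1 = w.1),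
      ∃ (p q : ℕ) (d : LDSDatum p q), d.IsRegular ∧
        UnitaryGroup.IsNondegenerateLimitOfDiscreteSeriesAt F₀ K cK N (StdForm.antidiagonal N)
          hcptK π'.1 hw hc d) →
    ∃ r : FramedGaloisRep K (PadicAlgCl ℓ) N, r.toGaloisRep.IsSemisimple ∧
      ∀ (u : HeightOneSpectrum (𝓞 K)) (β : Multiset ℂ), ((ℓ : ℕ) : 𝓞 K) ∉ u.asIdeal →
        (∀ u' : HeightOneSpectrum (𝓞 K), u'.asIdeal.under ℤ = u.asIdeal.under ℤ →
          u'.asIdeal.ramificationIdx ℤ = 1 ∧ UnitaryGroup.IsUnramifiedAt F₀ K cK N hcptK π'.1 u') →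
        UnitaryGroup.HasBaseChangeSatakeAt F₀ K cK N hcptK π'.1 u β →
          r.IsUnramifiedAt u ∧ r.HasFrobCharpolyAt u (arithFrobPolyOfSatake ι u.residueCard N β)

/-- **EigenApprox** (card A, the lever, stub T2): for `σ` exactly as in the crux (cuspidal on
`U_{K/F₀}(N)`, non-degenerate limit of discrete series at every real place, `ℓ ∉ Ram(G) ∪ Ram(σ)`)
and every `m`, there is a cuspidal `π'` on the same group which is DISCRETE SERIES at every real
place, unramified at every good place `u ∤ ℓ` of the crux's conclusion, and whose base-change
Satake polynomials there are congruent to those of `σ` modulo `ℓ^m`, uniformly in `u`.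
(Boxer–Pilloni 2021, Thm. 342 (interior eigenvariety equidimensional of dimension `dim 𝒲`,
interior classes give points) + Thm. 339(2) (small slope + very regular weight ⇒ classical) +
accumulation of such weights at the weight of `σ`; `π'` may be ramified above `ℓ`.) -/
def LDSEigenApproxByDiscreteSeries : Prop :=
  ∀ (F₀ K : Type) [Field F₀] [NumberField F₀] [Field K] [NumberField K] [Algebra F₀ K]
    (cK : K ≃ₐ[F₀] K), IsTotallyReal F₀ → Module.finrank F₀ K = 2 → ∀ (hc : cK ≠ 1),
    IsTotallyComplex K → ∀ (N : ℕ) (ℓ : ℕ) [Fact ℓ.Prime] (ι : PadicAlgCl ℓ ≃+* ℂ)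
    (hcptK : isCompact_glFiniteIntegralLevel N K)
    (σ : UnitaryGroup.CuspidalAutomorphicRepData F₀ K cK N hcptK),
    (∀ (w : {w : InfinitePlace K // w.IsComplex}) (hw : cK • w.1 = w.1),
      ∃ (p q : ℕ) (d : LDSDatum p q),
        UnitaryGroup.IsNondegenerateLimitOfDiscreteSeriesAt F₀ K cK N (StdForm.antidiagonal N)
          hcptK σ.1 hw hc d) →
    (∀ u : HeightOneSpectrum (𝓞 K), ((ℓ : ℕ) : 𝓞 K) ∈ u.asIdeal →
      u.asIdeal.ramificationIdx ℤ = 1 ∧ UnitaryGroup.IsUnramifiedAt F₀ K cK N hcptK σ.1 u) →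
    ∀ m : ℕ, ∃ π' : UnitaryGroup.CuspidalAutomorphicRepData F₀ K cK N hcptK,
      (∀ (w : {w : InfinitePlace K // w.IsComplex}) (hw : cK • w.1 = w.1),
        ∃ (p q : ℕ) (d : LDSDatum p q), d.IsRegular ∧
          UnitaryGroup.IsNondegenerateLimitOfDiscreteSeriesAt F₀ K cK N (StdForm.antidiagonal N)
            hcptK π'.1 hw hc d) ∧
      ∀ (u : HeightOneSpectrum (𝓞 K)) (β : Multiset ℂ), ((ℓ : ℕ) : 𝓞 K) ∉ u.asIdeal →
        (∀ u' : HeightOneSpectrum (𝓞 K), u'.asIdeal.under ℤ = u.asIdeal.under ℤ →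
          u'.asIdeal.ramificationIdx ℤ = 1 ∧ UnitaryGroup.IsUnramifiedAt F₀ K cK N hcptK σ.1 u') →
        UnitaryGroup.HasBaseChangeSatakeAt F₀ K cK N hcptK σ.1 u β →
          UnitaryGroup.IsUnramifiedAt F₀ K cK N hcptK π'.1 u ∧
          ∀ β' : Multiset ℂ, UnitaryGroup.HasBaseChangeSatakeAt F₀ K cK N hcptK π'.1 u β' →
            ∀ k : ℕ, ‖(arithFrobPolyOfSatake ι u.residueCard N β').coeff k -
                (arithFrobPolyOfSatake ι u.residueCard N β).coeff k‖ ≤ (ℓ : ℝ) ^ (-(m : ℤ))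

/-- **Docking by Hecke-valued determinant packages** (card B, first lemma; pure Galois side).
`K` a number field, `ℓ` prime, `E/ℚ_ℓ` finite inside `ℚ̄_ℓ`, `S` a finite set of finite places,
`P u ∈ ℚ̄_ℓ[X]` (`u ∉ S`) predicted polynomials with `ℓ`-integral coefficients in `E`.  Suppose a
nilpotence bound `ν` and, for every `m`, a topological commutative ring `T` (a Hecke algebra of
REGULAR cusp forms: Pilloni–Stroh's `T^{p-ad}(κ,n)`, Scholze's `𝕋_cl` quotients), an ideal
`J ⊆ T` with `J ^ ν = 0`, a continuous `N`-dimensional Galois determinant `D` over `T ⧸ J`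
unramified off `S ∪ {u ∣ ℓ}` with Frobenius characteristic polynomials `Q u mod J`, and a ring
homomorphism `θ : T → 𝒪_{ℚ̄_ℓ} ⧸ (ℓ^m)` with open kernel (the eigensystem of `σ` modulo `ℓ^m`)
carrying the coefficients of `Q u` to those of `P u`.  Then there is a continuous semisimple
`r : Γ_K → GL_N(ℚ̄_ℓ)` unramified off `S ∪ {u ∣ ℓ}` with `charpoly r(Frob_u) = P u`.
(Chenevier: base change and Amitsur uniqueness of determinants, determinants over `ℚ̄_ℓ` are
`det ∘ r` of a semisimple `r`; Chebotarev; in the tree: the proof pattern of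
`exists_semisimple_galoisRep_of_ladicLimit` and `BellaicheChenevier2009_continuous_rep_of_pseudocharacter_holds`.) -/
def GaloisRepOfHeckeDeterminantPackages : Prop :=
  ∀ (K : Type) [Field K] [NumberField K] (N ℓ : ℕ) [Fact ℓ.Prime]
    (E : IntermediateField ℚ_[ℓ] (PadicAlgCl ℓ)) [FiniteDimensional ℚ_[ℓ] E]
    (S : Set (HeightOneSpectrum (𝓞 K))), S.Finite →
    ∀ (P : HeightOneSpectrum (𝓞 K) → (PadicAlgCl ℓ)[X]),
    (∀ u ∉ S, ∀ k : ℕ, (P u).coeff k ∈ E ∧ ‖(P u).coeff k‖ ≤ 1) →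
    ∀ ν : ℕ,
    (∀ m : ℕ, ∃ (T : Type) (_ : CommRing T) (_ : TopologicalSpace T) (_ : IsTopologicalRing T)
        (J : Ideal T) (D : GaloisDeterminant K (T ⧸ J) N)
        (Q : HeightOneSpectrum (𝓞 K) → T[X])
        (θ : T →+* ((Valued.v (R := PadicAlgCl ℓ)).integer ⧸
          Ideal.span {(((ℓ : ℕ) : (Valued.v (R := PadicAlgCl ℓ)).integer)) ^ m})),
        J ^ ν = ⊥ ∧ D.IsContinuous ∧ IsOpen ((RingHom.ker θ : Set T)) ∧
        (∀ u ∉ S, ((ℓ : ℕ) : 𝓞 K) ∉ u.asIdeal →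
          D.IsUnramifiedAt u ∧ D.HasFrobCharpolyAt u ((Q u).map (Ideal.Quotient.mk J)) ∧
          ∀ k : ℕ, ∃ x : (Valued.v (R := PadicAlgCl ℓ)).integer,
            (x : PadicAlgCl ℓ) = (P u).coeff k ∧ θ ((Q u).coeff k) = Ideal.Quotient.mk _ x)) →
    ∃ r : FramedGaloisRep K (PadicAlgCl ℓ) N, r.toGaloisRep.IsSemisimple ∧
      ∀ u ∉ S, ((ℓ : ℕ) : 𝓞 K) ∉ u.asIdeal → r.IsUnramifiedAt u ∧ r.HasFrobCharpolyAt u (P u)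

/-- **Point version** (card B, completed-cohomology realisation variant): a CONTINUOUS
characteristic-zero point `θ : T → ℚ̄_ℓ` of a topological ring carrying an `N`-dimensional Galois
determinant modulo a nilpotent ideal (the tree's `HasHeckeDeterminant`-shape, arithmetic
convention) yields the semisimple `r` (a reduced target kills the nilpotent ideal; Chenevier,
Thm. 2.12). Receives Scholze 2015 Thm. IV.3.1 + Cor. V.1.11 on the completed cohomology of the
unitary Shimura variety once `σ` is realised there (Pan 2022; Rodríguez Camargo 2022/2026). -/
def GaloisRepOfHeckeDeterminantPoint : Prop :=
  ∀ (K : Type) [Field K] [NumberField K] (N ℓ ν : ℕ) [Fact ℓ.Prime]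
    (S : Set (HeightOneSpectrum (𝓞 K))) (T : Type) (_ : CommRing T) (_ : TopologicalSpace T)
    (_ : IsTopologicalRing T) (J : Ideal T) (D : GaloisDeterminant K (T ⧸ J) N)
    (Q : HeightOneSpectrum (𝓞 K) → T[X]) (θ : T →+* PadicAlgCl ℓ),
    J ^ ν = ⊥ → D.IsContinuous → Continuous θ →
    (∀ u ∉ S, D.IsUnramifiedAt u ∧ D.HasFrobCharpolyAt u ((Q u).map (Ideal.Quotient.mk J))) →
    ∃ r : FramedGaloisRep K (PadicAlgCl ℓ) N, r.toGaloisRep.IsSemisimple ∧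
      ∀ u ∉ S, r.IsUnramifiedAt u ∧ r.HasFrobCharpolyAt u ((Q u).map θ)

/-! Sanity: the crux is the named fact (so every card's assembly ends in the crux BY NAME). -/
example : Summit.Langlands.Langlands.Theses.QuadraticWindow.GaloisRepOfUnitaryLDS ↔
    GoldringKoskivirta2019_galoisRep_unitary := Iff.rfl

end Summit.Langlands.Langlands.Cruxes.GaloisRepOfUnitaryLDS.Sketch
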